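import Summits.Langlands.Langlands.Statement
import Summits.Langlands.Langlands.Theorems.SoloBlindUniqueness
import Literature.NumberTheory.GaloisRepresentations.ToLocalRestrictField
import Literature.NumberTheory.GaloisRepresentations.InducedAEUnramified
import Literature.NumberTheory.PAdicHodge.DeRhamBaseChangeProofs
import HarnessLib

/-!
# `Langlands` contains base change for `GL_n` along EVERY finite extension — as an instance, in the tree

A second necessary waypoint of any proof of summit `Langlands`, made formal (companion of
`SoloBlindArtin`).  Geometricity for the pinned data restricts along an arbitrary extension of number
fields `L/K` — unconditionally, in the tree: unramified almost everywhere restricts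
(`FramedGaloisRep.eventually_isUnramifiedAt_restrictField`) and de Rham for Fontaine's pinned data
restricts place by place (`isDeRhamFramed_toLocal_restrictField` with the tree's theorem
`DeRhamBaseChange_holds`, Brinon–Conrad Prop. 6.3.8): `SoloBlind.isGeometricFramed_restrictField`.
Hence conjunct (A) in degree `n` over `K` together with conjunct (B) in degree `n` over `L` yields BASE
CHANGE `BC_{L/K}` for every L-algebraic cuspidal `π` of `GL_n(𝔸_K)` whose Galois representation stays
irreducible on `Γ_L` — for EVERY finite extension `L/K`, Galois or not, solvable or not
(`SoloBlind.exists_baseChange`, `SoloBlind.exists_baseChange_of_langlands`).  Base change is known for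
solvable Galois extensions (Langlands 1980 for `GL_2`, Arthur–Clozel 1989 for `GL_n`) and in scattered
non-solvable cases by potential automorphy; for a general non-solvable extension (already an
`A_5`-quintic `L/ℚ` and a weight-one or Maass-type `π`) it is open, and the summit must decide it.

## References

* R. P. Langlands, *Base change for GL(2)*, Ann. of Math. Stud. 96 (1980). [LanglandsBaseChange1980]
* J. Arthur, L. Clozel, *Simple algebras, base change, and the advanced theory of the trace formula*,
  Ann. of Math. Stud. 120 (1989), Ch. 3 Thm. 4.2 and Thm. 5.1. [ArthurClozel1989]
* O. Brinon, B. Conrad, *CMI summer school notes on p-adic Hodge theory* (2009), Prop. 6.3.8.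
  [BrinonConrad2009]
* K. Buzzard, T. Gee, LMS Lecture Notes 414 (2014), Conj. 3.2.1–3.2.2. [BuzzardGeeLMS2014]
-/

open scoped MatrixGroups Matrix Classical NumberField
open NumberField IsDedekindDomain Filter Field
open Literature.NumberTheory.Automorphic Literature.NumberTheory.GaloisRepresentations
open Literature.NumberTheory.PAdicHodge

noncomputable section

namespace Summit.Langlands.Langlands.Theorems

namespace SoloBlind

variable {K L : Type} [Field K] [NumberField K] [Field L] [NumberField L] [Algebra K L]
  {ℓ : ℕ} [Fact ℓ.Prime] {n : ℕ}

/-- **Geometricity for the pinned data restricts along every finite extension `L/K`** (unconditional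
in the tree): unramified almost everywhere restricts, and de Rham for Fontaine's pinned datum at each
`w ∣ ℓ` of `L` follows from de Rham at `w ∩ 𝓞 K` by the tree's `DeRhamBaseChange_holds`.
[cite: BrinonConrad2009, Prop. 6.3.8] [cite: SerreAbelianLadic1968, Ch. I §2.1] -/
theorem isGeometricFramed_restrictField (𝓡K : ReciprocityData K) (𝓡L : ReciprocityData L)
    (ρ : FramedGaloisRep K (PadicAlgCl ℓ) n) (h : IsGeometricFramed 𝓡K ρ) :
    IsGeometricFramed 𝓡L (ρ.restrictField L) :=
  ⟨ρ.eventually_isUnramifiedAt_restrictField h.1,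
    fun w hw ↦ isDeRhamFramed_toLocal_restrictField DeRhamBaseChange_holds ρ h.2 w hw⟩

/-- **(A) over `K` and (B) over `L`, in degree `n`, give base change `BC_{L/K}` on `GL_n`** for every
L-algebraic cuspidal `π` of `GL_n(𝔸_K)` whose Galois representation `r_{ℓ,ι}(π)|_{Γ_L}` is irreducible:
there is an L-algebraic cuspidal `Π` of `GL_n(𝔸_L)` with `r_{ℓ,ι}(Π) = r_{ℓ,ι}(π)|_{Γ_L}` and
local–global compatibility at every finite place of `L` — for an ARBITRARY finite extension `L/K`.
[cite: ArthurClozel1989, Ch. 3 Thm. 4.2 (the solvable Galois case, unconditionally)]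
[cite: BuzzardGeeLMS2014, Conj. 3.2.1–3.2.2] -/
theorem exists_baseChange {𝓡K : ReciprocityData K} {𝓡L : ReciprocityData L}
    {hcptK : isCompact_glFiniteIntegralLevel n K} {hcptL : isCompact_glFiniteIntegralLevel n L}
    (hA : AutomorphicToGalois n 𝓡K hcptK) (hB : GaloisToAutomorphic n 𝓡L hcptL)
    (π : CuspidalAutomorphicRepData n K hcptK) (hπ : π.1.IsLAlgebraic) (ι : PadicAlgCl ℓ ≃+* ℂ) :
    ∃ ρ : FramedGaloisRep K (PadicAlgCl ℓ) n,
      ρ.toGaloisRep.IsIrreducible ∧ IsGeometricFramed 𝓡K ρ ∧ Corresponds 𝓡K ι π.1 ρ ∧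
      IsGeometricFramed 𝓡L (ρ.restrictField L) ∧
      ((ρ.restrictField L).toGaloisRep.IsIrreducible →
        ∃ πL : CuspidalAutomorphicRepData n L hcptL,
          πL.1.IsLAlgebraic ∧ Corresponds 𝓡L ι πL.1 (ρ.restrictField L)) := by
  obtain ⟨ρ, hirr, hgeo, hcorr, -⟩ := hA π hπ ℓ ι
  exact ⟨ρ, hirr, hgeo, hcorr, isGeometricFramed_restrictField 𝓡K 𝓡L ρ hgeo,
    fun hirrL ↦ hB ℓ ι _ hirrL (isGeometricFramed_restrictField 𝓡K 𝓡L ρ hgeo)⟩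

omit [Algebra K L] in
/-- **Summit `Langlands` decides base change along every finite extension of number fields**
(`exists_baseChange` with both conjuncts supplied by the summit; any pinned data `𝓡K`, `𝓡L`).
[cite: ArthurClozel1989, Ch. 3 Thm. 4.2] [cite: BuzzardGeeLMS2014, Conj. 3.2.1–3.2.2] -/
theorem exists_baseChange_of_langlands (h : Langlands) [Algebra K L] (hn : 0 < n)
    (𝓡K : ReciprocityData K) (𝓡L : ReciprocityData L)
    (hcptK : isCompact_glFiniteIntegralLevel n K) (hcptL : isCompact_glFiniteIntegralLevel n L)
    (π : CuspidalAutomorphicRepData n K hcptK) (hπ : π.1.IsLAlgebraic) (ι : PadicAlgCl ℓ ≃+* ℂ) :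
    ∃ ρ : FramedGaloisRep K (PadicAlgCl ℓ) n,
      ρ.toGaloisRep.IsIrreducible ∧ IsGeometricFramed 𝓡K ρ ∧ Corresponds 𝓡K ι π.1 ρ ∧
      IsGeometricFramed 𝓡L (ρ.restrictField L) ∧
      ((ρ.restrictField L).toGaloisRep.IsIrreducible →
        ∃ πL : CuspidalAutomorphicRepData n L hcptL,
          πL.1.IsLAlgebraic ∧ Corresponds 𝓡L ι πL.1 (ρ.restrictField L)) :=
  exists_baseChange ((h K).2 𝓡K n hn hcptK).1 ((h L).2 𝓡L n hn hcptL).2 π hπ ι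

end SoloBlind

end Summit.Langlands.Langlands.Theorems

end
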